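import Literature.Combinatorics.SimpleGraph.BrinkmannTuckerVanCleemput2021.Verdict
import Literature.Combinatorics.SimpleGraph.BrinkmannTuckerVanCleemput2021.CyclicConnectivity
import HarnessLib

/-!
# `G70` is a polyhedrally embedded snark on fewer vertices than Kochol's

Brinkmann, Tucker and Van Cleemput [BrinkmannTuckerVancleemput2021, §3.1] recall Kochol's
[Kochol2008] 74-vertex snark with a polyhedral embedding of genus 5 — the first cubic graph with a
polyhedral embedding in an orientable surface that is not 3-edge-colourable, against Grünbaum
(1969) — and write: "It is neither known whether Kochol's graph is the smallest counterexample nor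
whether there are counterexamples with smaller genus."  `…Verdict.smaller_than_kochol` answers
the first question with the 70-vertex cubic class-2 graph `G70` of girth 5 and its genus-5
polyhedral rotation system, leaving the word *snark* half-certified: connectivity and cyclic
4-edge-connectivity were checked only outside Lean.  `…Connectivity` and `…CyclicConnectivity`
now supply kernel-checked walk certificates, and this module restates the verdict in full:
`G70` is a 3-connected, 3-edge-connected, cyclically 4-edge-connected cubic graph of girth 5 and
chromatic index 4 — a snark in the strictest usual sense — on `70 < 74` vertices, with a
polyhedral embedding of genus 5 (`polyhedral_snark_smaller_than_kochol`).  Whether 70 is optimal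
and the second question (genus `≤ 4`) remain as they were.

Standard axioms throughout (`decide +kernel`, no `native_decide`).  Not formalised, as before:
the Heffter–Edmonds–Ringel dictionary between rotation systems and cellular embeddings.

Provenance: refutations bundle `papers/_cross/refutations` (H21 seat pub-refute-2, 2026-08-18);
written for the tree under the Lean-in-tree rule (human 2026-08-18).
-/

namespace Literature.Combinatorics.SimpleGraph.BrinkmannTuckerVanCleemput2021

open _root_.SimpleGraph

/-- **`G70` is 3-connected**: connected, more than three vertices, and connected after deleting
any one or two vertices (`u = v` allowed). [folklore] -/
theorem three_connected :
    G70.Connected ∧ 3 < Fintype.card (Fin 70) ∧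
      ∀ u v : Fin 70, (G70.induce {w : Fin 70 | w ≠ u ∧ w ≠ v}).Connected :=
  ⟨connected, by simp, connected_induce_compl_pair⟩

/-- **`G70` is a snark**: cubic, girth `5`, cyclically 4-edge-connected (every edge cut with at
least two vertices on each side has at least four edges) and not 3-edge-colourable.
[cite: BrinkmannTuckerVancleemput2021, §3.1] -/
theorem snark :
    G70.IsRegularOfDegree 3 ∧ G70.girth = 5 ∧
      (∀ A : Finset (Fin 70), 2 ≤ A.card → 2 ≤ Aᶜ.card → 4 ≤ (G70.interedges A Aᶜ).card) ∧
      ¬ G70.lineGraph.Colorable 3 :=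
  ⟨isRegularOfDegree_three, girth_eq_five, four_le_card_cut, not_colorable_three⟩

/-- **A polyhedrally embedded snark smaller than Kochol's.**  `G70` has `70 < 74` vertices; it
is cubic, of girth `5`, cyclically 4-edge-connected and not 3-edge-colourable (a snark); it is
connected, 3-connected (deleting any `≤ 2` vertices leaves it connected) and 3-edge-connected;
and its rotation system is a polyhedral embedding of genus `5`: the `27` faces partition the
`210` darts and are the orbits of face tracing, every facial walk is a simple cycle, distinct
faces meet polyhedrally (Definition 1 of the paper), and `V - E + F = 2 - 2·5`.
[cite: BrinkmannTuckerVancleemput2021, §3.1] -/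
theorem polyhedral_snark_smaller_than_kochol :
    Fintype.card (Fin 70) < 74 ∧
      (G70.IsRegularOfDegree 3 ∧ G70.girth = 5 ∧
        (∀ A : Finset (Fin 70), 2 ≤ A.card → 2 ≤ Aᶜ.card → 4 ≤ (G70.interedges A Aᶜ).card) ∧
        ¬ G70.lineGraph.Colorable 3) ∧
      (G70.Connected ∧ (∀ u v : Fin 70, (G70.induce {w : Fin 70 | w ≠ u ∧ w ≠ v}).Connected) ∧
        G70.IsEdgeConnected 3) ∧
      ((∀ d : Dart, (faceList.map fun f => f.count d).sum = 1) ∧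
        (∀ f ∈ faceList, f ≠ [] ∧ ∀ k : Fin f.length,
          nextDart (f.get k) = f.get ⟨(k + 1) % f.length, Nat.mod_lt _ (Fin.pos k)⟩) ∧
        (∀ f ∈ faceList, 3 ≤ f.length ∧ (fverts f).Nodup) ∧
        (∀ f ∈ faceList, ∀ g ∈ faceList, f ≠ g → MeetPolyhedrally f g) ∧
        faceList.length = 27 ∧ eulerChar = 2 - 2 * 5) := by
  obtain ⟨h74, -, -, -, hcov, horb, hsimp, hmeet, hlen, heul⟩ := smaller_than_kochol
  exact ⟨h74, snark, ⟨connected, connected_induce_compl_pair, isEdgeConnected_three⟩, hcov, horb,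
    hsimp, hmeet, hlen, heul⟩

end Literature.Combinatorics.SimpleGraph.BrinkmannTuckerVanCleemput2021
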